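import Literature.MathematicalPhysics.QuantumLattice.HubbardDressedClusterTorusEnergySum
import Literature.MathematicalPhysics.QuantumLattice.HubbardTTPrimeGrandCanonicalEnsembleEquivalence
import Literature.MathematicalPhysics.QuantumLattice.HubbardTTPrimeGrandCanonicalPressureTorusBridge
import Literature.MathematicalPhysics.QuantumLattice.HubbardDressedClusterNodeRegularise
import HarnessLib

/-!
# The seam-dressed cluster pressure floor (certificate C3): `pressureTT' β t t' U n ≥ (S(σ) − β·E_box(σ, W))/(ab)`

Topic `Literature/MathematicalPhysics/QuantumLattice` (namespace = path; family `hubbard`). The kernel theorem behind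
certificate **C3** of the `T > 0` Hubbard programme (sr-mbsolver/hubbard-thermal, technique (ii): free-energy trial
states). Given ONE faithful even density matrix `σ` on the box `[0,a) × [0,b)` with particle density `n`
(`Re tr(σN) = n·ab`) and ONE LAYER of separated, number-conserving unitary gates `u_g` on supports
`G g ⊆ [−a,2a) × [−b,2b)`, the canonical `S^z = 0` pressure of record of the two-dimensional `t–t'–U` Hubbard model
satisfies

  `(vonNeumannEntropy σ − β · SeamDressed.boxEnergy a b G … σ … t t' U)/(a b) ≤ pressureTT' β t t' U n`

(`dressedCluster_le_pressureTT'`; `β > 0`, `U ≥ 0`, `0 < n < 2`). Route (GRAND-CANONICAL, no type classes): on the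
square torus `L_j = (j+9)·ab = K_x a = K_y b` the trial state `ρ' = W (Π_v Γ_{box v} σ) Wᴴ` has `S(ρ') = K_x K_y S(σ)`
(`vonNeumannEntropy_trialState`), `Re tr(ρ' H_L) = K_x K_y E_box` (`re_trace_trialState_mul_hubbardTorusTT'`),
`Re tr(ρ' N) = K_x K_y · n ab` (`trace_trialState_mul_totalNumber`); the Gibbs variational principle
(`IsHermitian.vonNeumannEntropy_sub_mul_le_log_partitionFn`) gives `L_j² · W(μ) ≤ log Ξ_{L_j}(β, μ)` with
`W(μ) = (S(σ) − βE_box + βμ n ab)/(ab)` EXACTLY at every finite volume, whence `W(μ) ≤ gcPressureTT' β t t' U μ`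
(`le_gcPressureTT'_of_eventually_torus`) for every `μ`, and the equivalence of ensembles
`pressureTT' n = ⨅_μ [gcPressureTT' μ − βμn]` (`pressureTT'_eq_iInf_gcPressureTT'`, Ruelle 1969 §3.4) concludes.

Also the reader's shapes: `le_pressureTT'_of_dressedClusterBounds` (from certified `S⁻ ≤ S(σ)`, `E_box ≤ E⁺` and the
exact-arithmetic check `W₀·ab ≤ S⁻ − βE⁺`), the `∀ ε > 0, ∀ᶠ j` floor along every `Ls → ∞`, and THE LAST LINK from
the kernel's claim nodes (`SeamDressed.FloorNode` / `SeamDressed.Node`, `HubbardDressedClusterNode.lean`, whose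
witness is only positive SEMIdefinite): `le_pressureTT'_of_floorNode`, `le_pressureTT'_of_node` — through the
regularisation `FloorNode.le_of_posDef_bound` (`HubbardDressedClusterNodeRegularise.lean`).

Everything is PROVED; no definition, no named fact. HONEST SCOPE: the direct theorem takes `σ` faithful (`PosDef`);
the claim-node corollaries accept `σ ⪰ 0` (regularisation); the four local traces per site of `boxEnergy` are certified
numerically off-kernel and enter through the claim node.

## References

* D. Ruelle, *Statistical Mechanics: Rigorous Results* (1969), §3.4 (equivalence of ensembles). [cite: Ruelle1969, §3.4]
* R. B. Israel, *Convexity in the Theory of Lattice Gases* (1979), Thm. I.2.4, Lemma II.3.1. [cite: Israel1979, Thm. I.2.4]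
* S. J. Gustafson, I. M. Sigal, *Mathematical Concepts of Quantum Mechanics* (2003), §18.3 (Gibbs variational
  principle). [cite: GustafsonSigal2003, §18.3]
* M. Kliesch, C. Gogolin, M. J. Kastoryano, A. Riera, J. Eisert, Phys. Rev. X 4 (2014) 031019, §II. [cite: KlieschEtAl2014, §II]
-/

noncomputable section

namespace Literature.MathematicalPhysics.QuantumLattice

open Matrix Finset HubbardWave0 Literature.Probability.LatticeModels AndersonCluster ThermodynamicLimit LiebThm1
open _root_.Filter
open scoped _root_.Topology ComplexOrder BigOperators
open Literature.InformationTheory.Entropy (vonNeumannEntropy)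

namespace SeamDressed

section Floor

/-- (Local to this file.) Equality of torus sites is decided through the linear order — the instance the generic
Jordan–Wigner lemmas carry. [folklore] -/
noncomputable local instance (priority := high) instDecidableEqFermionTorusSeamDressedFloor {L : ℕ} :
    DecidableEq (FermionTorus 2 L) :=
  LinearOrder.toDecidableEq

variable {a b : ℕ} [NeZero a] [NeZero b] {m : ℕ} {G : Fin m → Finset (Site 2)} (hG : ∀ g, G g ⊆ gateRange a b)
  (hsep : ∀ g g', ∀ x ∈ G g, ∀ x' ∈ G g', ((a : ℤ) ∣ x' 0 - x 0) → ((b : ℤ) ∣ x' 1 - x 1) → g = g' ∧ x = x')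
  {u : ∀ g, FermionOp (G g)} (huU : ∀ g, (u g)ᴴ * u g = 1) (huN : ∀ g, Commute totalNumber (u g))
  {σ : FermionOp (rectWindow a b)} (hσpd : σ.PosDef) (hσtr : σ.trace = 1) (hσN : Commute totalNumber σ)
  {β t t' U : ℝ}

/-- Number-conserving gates are even. [cite: ArakiMoriya2003, §4.1 Def. 4.2] -/
theorem gates_even (huN : ∀ g, Commute totalNumber (u g)) : ∀ g, parityAut (u g) = u g :=
  fun g => parityAut_eq_self_of_commute_totalNumber (huN g)

omit [NeZero a] [NeZero b] in
/-- A number-conserving box state is even. [cite: ArakiMoriya2003, §4.1 Def. 4.2] -/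
theorem box_even (hσN : Commute totalNumber σ) : parityAut σ = σ := parityAut_eq_self_of_commute_totalNumber hσN

/-- `Re (n · z) = n · Re z` for a natural number `n`. [folklore] -/
private theorem re_natCast_mul' (n : ℕ) (z : ℂ) : ((n : ℂ) * z).re = n * z.re := by
  rw [← Complex.ofReal_natCast, Complex.re_ofReal_mul]

include hG huU hσpd hσtr in
/-- **The finite-volume Gibbs variational inequality for the seam-dressed cluster state** on the square torus
`L = K_x a = K_y b` (`K_x, K_y ≥ 9`), EXACT at every volume:
`K_x K_y · (S(σ) − β (E_box − μ Re tr(σN))) ≤ log Re Ξ_L(β, μ)`. [cite: GustafsonSigal2003, §18.3] -/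
theorem mul_le_log_partitionFn_grandCanonical (L : ℕ) [NeZero L] {Kx Ky : ℕ} [NeZero Kx] [NeZero Ky]
    (hLx : (L : ℤ) = Kx * a) (hLy : (L : ℤ) = Ky * b) (hK : 9 ≤ Kx ∧ 9 ≤ Ky) (β μ t t' U : ℝ) :
    ((Kx * Ky : ℕ) : ℝ) * (vonNeumannEntropy σ -
        β * (boxEnergy a b G hsep u (gates_even huN) σ (box_even hσN) t t' U - μ * (σ * (totalNumber : FermionOp (rectWindow a b))).trace.re)) ≤
      Real.log (partitionFn β (hubbardTorusTT' L t t' U - (μ : ℂ) • totalNumber)).re := by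
  have hK3 : 3 ≤ Kx ∧ 3 ≤ Ky := ⟨le_trans (by norm_num) hK.1, le_trans (by norm_num) hK.2⟩
  have hN : (totalNumber : Matrix (Finset (Orb (FermionTorus 2 L))) (Finset (Orb (FermionTorus 2 L))) ℂ).IsHermitian := by
    rw [Matrix.IsHermitian, totalNumber_eq_diagonal_card, Matrix.diagonal_conjTranspose]
    congr 1
    funext s
    simp
  have hμN : ((μ : ℂ) • (totalNumber : Matrix (Finset (Orb (FermionTorus 2 L))) (Finset (Orb (FermionTorus 2 L))) ℂ)).IsHermitian := by
    rw [Matrix.IsHermitian, Matrix.conjTranspose_smul, hN.eq, Complex.star_def, Complex.conj_ofReal]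
  have hH : (hubbardTorusTT' L t t' U - (μ : ℂ) • totalNumber).IsHermitian := (hubbardTorusTT'_isHermitian L t t' U).sub hμN
  have hGVP := hH.vonNeumannEntropy_sub_mul_le_log_partitionFn β
    (posSemidef_trialState a b L hLx hLy G hG hK3 hsep u (gates_even huN) σ (box_even hσN) hσpd.posSemidef)
    (trace_trialState a b L hLx hLy G hG hK3 hsep u (gates_even huN) σ (box_even hσN) huU hσtr)
  -- the entropy identity of the state file is stated with that file's (subsingleton) `DecidableEq` instance path
  have hS : vonNeumannEntropy (trialState a b L hLx hLy G hG hK3 hsep u (gates_even huN) σ (box_even hσN)) =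
      ((Kx * Ky : ℕ) : ℝ) * vonNeumannEntropy σ := by
    convert vonNeumannEntropy_trialState a b L hLx hLy G hG hK3 hsep u (gates_even huN) σ (box_even hσN) huU hσpd hσtr using 2
  rw [hS, Matrix.mul_sub, Matrix.trace_sub, Complex.sub_re, Matrix.mul_smul, Matrix.trace_smul, smul_eq_mul,
    Complex.re_ofReal_mul, re_trace_trialState_mul_hubbardTorusTT' a b L hLx hLy G hG hK3 hK hsep u (gates_even huN) huU
      σ (box_even hσN) hσtr,
    trace_trialState_mul_totalNumber a b L hLx hLy G hG hK3 hsep u (gates_even huN) σ (box_even hσN) huU huN hσtr,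
    re_natCast_mul'] at hGVP
  have e : ((Kx * Ky : ℕ) : ℝ) * (vonNeumannEntropy σ -
        β * (boxEnergy a b G hsep u (gates_even huN) σ (box_even hσN) t t' U - μ * (σ * (totalNumber : FermionOp (rectWindow a b))).trace.re)) =
      ((Kx * Ky : ℕ) : ℝ) * vonNeumannEntropy σ - β * (((Kx * Ky : ℕ) : ℝ) * boxEnergy a b G hsep u (gates_even huN) σ (box_even hσN) t t' U -
        μ * (((Kx * Ky : ℕ) : ℝ) * (σ * (totalNumber : FermionOp (rectWindow a b))).trace.re)) := by ring
  rw [e]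
  exact hGVP

include hG huU hσpd hσtr in
/-- **The grand-canonical floor**: for every chemical potential `μ` (`β ≥ 0`, `U ≥ 0`),
`(S(σ) − β E_box + βμ Re tr(σN))/(ab) ≤ gcPressureTT' β t t' U μ`. [cite: Ruelle1969, §3.4] -/
theorem le_gcPressureTT'_dressedCluster (hβ : 0 ≤ β) (hU : 0 ≤ U) (μ : ℝ) :
    (vonNeumannEntropy σ - β * boxEnergy a b G hsep u (gates_even huN) σ (box_even hσN) t t' U +
        β * μ * (σ * (totalNumber : FermionOp (rectWindow a b))).trace.re) / (a * b) ≤ gcPressureTT' β t t' U μ := by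
  have ha : (0 : ℝ) < a := by exact_mod_cast Nat.pos_of_ne_zero (NeZero.ne a)
  have hb : (0 : ℝ) < b := by exact_mod_cast Nat.pos_of_ne_zero (NeZero.ne b)
  -- the tori `L_j = (j + 9)·a·b`, `K_x = (j+9) b`, `K_y = (j+9) a`
  set Ls : ℕ → ℕ := fun j => (j + 9) * (a * b) with hLs
  have hLs' : Tendsto Ls atTop atTop := by
    refine tendsto_atTop_mono (fun j => ?_) tendsto_id
    have : 1 ≤ a * b := Nat.mul_pos (Nat.pos_of_ne_zero (NeZero.ne a)) (Nat.pos_of_ne_zero (NeZero.ne b))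
    show j ≤ (j + 9) * (a * b)
    nlinarith
  refine le_gcPressureTT'_of_eventually_torus hβ t t' hU μ hLs' fun ε hε => Filter.Eventually.of_forall fun j => ?_
  haveI : NeZero (Ls j) := ⟨Nat.mul_ne_zero (by omega) (Nat.mul_ne_zero (NeZero.ne a) (NeZero.ne b))⟩
  haveI : NeZero ((j + 9) * b) := ⟨Nat.mul_ne_zero (by omega) (NeZero.ne b)⟩
  haveI : NeZero ((j + 9) * a) := ⟨Nat.mul_ne_zero (by omega) (NeZero.ne a)⟩
  have hLx : ((Ls j : ℕ) : ℤ) = (((j + 9) * b : ℕ) : ℤ) * a := by rw [hLs]; push_cast; ring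
  have hLy : ((Ls j : ℕ) : ℤ) = (((j + 9) * a : ℕ) : ℤ) * b := by rw [hLs]; push_cast; ring
  have hK : 9 ≤ (j + 9) * b ∧ 9 ≤ (j + 9) * a :=
    ⟨le_trans (by omega) (Nat.le_mul_of_pos_right _ (Nat.pos_of_ne_zero (NeZero.ne b))),
      le_trans (by omega) (Nat.le_mul_of_pos_right _ (Nat.pos_of_ne_zero (NeZero.ne a)))⟩
  have hfin := mul_le_log_partitionFn_grandCanonical hG hsep huU huN hσpd hσtr hσN (Ls j) hLx hLy hK β μ t t' U
  -- `(W − ε) L² ≤ W L² = K_x K_y · (…)`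
  have hL2 : ((Ls j : ℕ) : ℝ) ^ 2 = (((j + 9) * b * ((j + 9) * a) : ℕ) : ℝ) * (a * b) := by
    rw [hLs]; push_cast; ring
  have hsq : 0 ≤ ((Ls j : ℕ) : ℝ) ^ 2 := sq_nonneg _
  calc (( vonNeumannEntropy σ - β * boxEnergy a b G hsep u (gates_even huN) σ (box_even hσN) t t' U +
          β * μ * (σ * (totalNumber : FermionOp (rectWindow a b))).trace.re) / (a * b) - ε) * ((Ls j : ℕ) : ℝ) ^ 2
      ≤ ((vonNeumannEntropy σ - β * boxEnergy a b G hsep u (gates_even huN) σ (box_even hσN) t t' U +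
          β * μ * (σ * (totalNumber : FermionOp (rectWindow a b))).trace.re) / (a * b)) * ((Ls j : ℕ) : ℝ) ^ 2 := by
        nlinarith
    _ = (((j + 9) * b * ((j + 9) * a) : ℕ) : ℝ) * (vonNeumannEntropy σ -
          β * (boxEnergy a b G hsep u (gates_even huN) σ (box_even hσN) t t' U - μ * (σ * (totalNumber : FermionOp (rectWindow a b))).trace.re)) := by
        rw [hL2]; field_simp; ring
    _ ≤ _ := by
        -- the dictionary lemma carries the structural `DecidableEq` instance path; bridge by subsingleton congruence
        convert hfin using 4

include hG huU hσpd hσtr in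
/-- **THE SEAM-DRESSED CLUSTER PRESSURE FLOOR (certificate C3).** For a faithful, number-conserving box density matrix
`σ` on `[0,a) × [0,b)` of density `n` (`Re tr(σN) = n·ab`) and one layer of separated, number-conserving unitary gates
on supports in `[−a,2a) × [−b,2b)`: `(S(σ) − β·E_box(σ, W))/(ab) ≤ pressureTT' β t t' U n`
(`β > 0`, `U ≥ 0`, `0 < n < 2`). [cite: Ruelle1969, §3.4] [cite: GustafsonSigal2003, §18.3] [cite: KlieschEtAl2014, §II] -/
theorem dressedCluster_le_pressureTT' (hβ : 0 < β) (hU : 0 ≤ U) {n : ℝ} (hn0 : 0 < n) (hn2 : n < 2)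
    (hσn : (σ * (totalNumber : FermionOp (rectWindow a b))).trace.re = n * (a * b)) :
    (vonNeumannEntropy σ - β * boxEnergy a b G hsep u (gates_even huN) σ (box_even hσN) t t' U) / (a * b) ≤
      pressureTT' β t t' U n := by
  have ha : (0 : ℝ) < a := by exact_mod_cast Nat.pos_of_ne_zero (NeZero.ne a)
  have hb : (0 : ℝ) < b := by exact_mod_cast Nat.pos_of_ne_zero (NeZero.ne b)
  rw [pressureTT'_eq_iInf_gcPressureTT' hβ.le t t' hU hβ hn0 hn2]
  refine le_ciInf fun μ => ?_
  have h := le_gcPressureTT'_dressedCluster hG hsep huU huN hσpd hσtr hσN (t := t) (t' := t') hβ.le hU μ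
  rw [hσn] at h
  have e : (vonNeumannEntropy σ - β * boxEnergy a b G hsep u (gates_even huN) σ (box_even hσN) t t' U +
        β * μ * (n * (a * b))) / (a * b) =
      (vonNeumannEntropy σ - β * boxEnergy a b G hsep u (gates_even huN) σ (box_even hσN) t t' U) / (a * b) + β * μ * n := by
    field_simp
  rw [e] at h
  linarith

include hG huU hσpd hσtr in
/-- **Reader's shape**: certified bounds `S⁻ ≤ S(σ)`, `E_box ≤ E⁺` and the exact-arithmetic check `W₀·(ab) ≤ S⁻ − β·E⁺`
give `W₀ ≤ pressureTT' β t t' U n` — the pressure-floor input of every temperature-axis reader.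
[cite: Ruelle1969, §3.4] [cite: Israel1979, Thm. I.2.4] -/
theorem le_pressureTT'_of_dressedClusterBounds (hβ : 0 < β) (hU : 0 ≤ U) {n : ℝ} (hn0 : 0 < n) (hn2 : n < 2)
    (hσn : (σ * (totalNumber : FermionOp (rectWindow a b))).trace.re = n * (a * b)) {Sl Eu W₀ : ℝ} (hS : Sl ≤ vonNeumannEntropy σ)
    (hE : boxEnergy a b G hsep u (gates_even huN) σ (box_even hσN) t t' U ≤ Eu) (hW : W₀ * (a * b) ≤ Sl - β * Eu) :
    W₀ ≤ pressureTT' β t t' U n := by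
  have ha : (0 : ℝ) < a := by exact_mod_cast Nat.pos_of_ne_zero (NeZero.ne a)
  have hb : (0 : ℝ) < b := by exact_mod_cast Nat.pos_of_ne_zero (NeZero.ne b)
  refine le_trans ?_ (dressedCluster_le_pressureTT' hG hsep huU huN hσpd hσtr hσN hβ hU hn0 hn2 hσn)
  rw [le_div_iff₀ (mul_pos ha hb)]
  have : β * boxEnergy a b G hsep u (gates_even huN) σ (box_even hσN) t t' U ≤ β * Eu :=
    mul_le_mul_of_nonneg_left hE hβ.le
  linarith

include hG huU hσpd hσtr in
/-- **The floor along every sequence of tori** (the `hW` shape of the torus-limit readers):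
`∀ ε > 0, ∀ᶠ j, (W₀ − ε)(Ls j)² ≤ log Re Z_β(sectorHamiltonianTT' t t' U n (Ls j))`. [cite: Israel1979, Thm. I.2.4] -/
theorem eventually_dressedCluster_floor (hβ : 0 < β) (hU : 0 ≤ U) {n : ℝ} (hn0 : 0 < n) (hn2 : n < 2)
    (hσn : (σ * (totalNumber : FermionOp (rectWindow a b))).trace.re = n * (a * b)) {Ls : ℕ → ℕ} (hLs : Tendsto Ls atTop atTop) {ε : ℝ} (hε : 0 < ε) :
    ∀ᶠ j in atTop, ((vonNeumannEntropy σ - β * boxEnergy a b G hsep u (gates_even huN) σ (box_even hσN) t t' U) / (a * b) - ε) *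
        (Ls j : ℝ) ^ 2 ≤ Real.log (partitionFn β (sectorHamiltonianTT' t t' U n (Ls j))).re :=
  eventually_sub_mul_sq_le_log_partitionFn_of_le_pressureTT' hβ.le t t' hU hn0.le hn2
    (dressedCluster_le_pressureTT' hG hsep huU huN hσpd hσtr hσN hβ hU hn0 hn2 hσn) hLs hε

end Floor

section Node

/-- **The last link: a C3 floor node gives the pressure floor.** A claim node `FloorNode t t' U a b n β W0` (witness
`σ ⪰ 0`, `tr σ = 1`, `[σ, N] = 0`, `Re tr(σN) = n·ab`, separated number-conserving unitary gates inside `gateRange a b`,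
`W0·ab ≤ S(σ) − β E_box`) yields `W0 ≤ pressureTT' β t t' U n` (`β > 0`, `U ≥ 0`, `0 < n < 2`): the regularisation
`FloorNode.le_of_posDef_bound` reduces to faithful witnesses, where `dressedCluster_le_pressureTT'` applies (the evenness
witnesses of `boxEnergy` are propositions, so the node's and this file's agree definitionally).
[cite: Ruelle1969, §3.4] [cite: Israel1979, Lemma II.3.1] -/
theorem le_pressureTT'_of_floorNode {t t' U : ℝ} {a b : ℕ} [NeZero a] [NeZero b] {n β W0 : ℝ} (hβ : 0 < β)
    (hU : 0 ≤ U) (hn0 : 0 < n) (hn2 : n < 2) (h : FloorNode t t' U a b n β W0) : W0 ≤ pressureTT' β t t' U n :=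
  h.le_of_posDef_bound hn0 hn2 fun _ _ hsep _ huN _ hσN hG huU hσpd hσtr hσn => by
    have ha : (0 : ℝ) < a := by exact_mod_cast Nat.pos_of_ne_zero (NeZero.ne a)
    have hb : (0 : ℝ) < b := by exact_mod_cast Nat.pos_of_ne_zero (NeZero.ne b)
    have h' := dressedCluster_le_pressureTT' hG hsep huU huN hσpd hσtr hσN (t := t) (t' := t') hβ hU hn0 hn2 hσn
    rwa [div_le_iff₀ (mul_pos ha hb)] at h'

/-- **Two-number node version**: `Node t t' U a b n S⁻ E⁺` and the certified arithmetic `W0·ab ≤ S⁻ − β E⁺` give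
`W0 ≤ pressureTT' β t t' U n`. [cite: Ruelle1969, §3.4] [cite: Israel1979, Lemma II.3.1] -/
theorem le_pressureTT'_of_node {t t' U : ℝ} {a b : ℕ} [NeZero a] [NeZero b] {n Slo Ehi β W0 : ℝ} (hβ : 0 < β)
    (hU : 0 ≤ U) (hn0 : 0 < n) (hn2 : n < 2) (h : Node t t' U a b n Slo Ehi) (harith : W0 * (a * b) ≤ Slo - β * Ehi) :
    W0 ≤ pressureTT' β t t' U n :=
  le_pressureTT'_of_floorNode hβ hU hn0 hn2 (floorNode_of_node h hβ.le harith)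

/-- **The floor node along every sequence of tori**: `∀ ε > 0, ∀ᶠ j, (W0 − ε)(Ls j)² ≤ log Re Z_β(H^{TT'}_{n, Ls j})` —
the `hW` input of the torus-limit temperature-axis readers. [cite: Israel1979, Thm. I.2.4] -/
theorem eventually_floor_of_floorNode {t t' U : ℝ} {a b : ℕ} [NeZero a] [NeZero b] {n β W0 : ℝ} (hβ : 0 < β)
    (hU : 0 ≤ U) (hn0 : 0 < n) (hn2 : n < 2) (h : FloorNode t t' U a b n β W0) {Ls : ℕ → ℕ}
    (hLs : Tendsto Ls atTop atTop) {ε : ℝ} (hε : 0 < ε) :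
    ∀ᶠ j in atTop, (W0 - ε) * (Ls j : ℝ) ^ 2 ≤ Real.log (partitionFn β (sectorHamiltonianTT' t t' U n (Ls j))).re :=
  eventually_sub_mul_sq_le_log_partitionFn_of_le_pressureTT' hβ.le t t' hU hn0.le hn2
    (le_pressureTT'_of_floorNode hβ hU hn0 hn2 h) hLs hε

end Node

end SeamDressed

end Literature.MathematicalPhysics.QuantumLattice

end
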